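import Summits.QuantumFields.QCD.Theses.PauliWegnerSea
import Literature.MathematicalPhysics.QuantumLattice.OverlapLocality
import Literature.MathematicalPhysics.QuantumLattice.WilsonPropagatorHeavyMass
import Literature.MathematicalPhysics.QuantumLattice.GrassmannIntegralWilsonProofs
import Literature.MathematicalPhysics.QuantumLattice.GaugeGroups

/-!
# Stub `stub_window` of crux `FibreCofactorDomination` (stmt-QuantumFields-11510)

Line `Sketch-ideator3` (card A `random-refit-second-moment`), route PauliWegnerSea (sub QCD).

Window saturation: at θ₀ = 11 > ‖γ₅ D_W‖ every characteristic root of γ₅ D_W(U) has |Re| < 11, so the in-window count equals the dimension 12 L⁴.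
-/

noncomputable section

namespace Summit.QuantumFields.QCD.Theorems.RandomRefit

open scoped BigOperators Matrix
open MeasureTheory Filter Literature.MathematicalPhysics.QuantumFieldTheory
  Literature.MathematicalPhysics.QuantumLattice Literature.Probability.LatticeModels
open scoped Matrix.Norms.L2Operator

/-- `‖1_Λ ⊗ 1_N ⊗ γ₅‖ ≤ 1` in the `ℓ²` operator norm: in the chiral basis `spinorLift γ₅` is the
diagonal sign matrix `diag(ε_{spin p})`, `ε = (1, 1, -1, -1)`, whose operator norm is the sup norm
of its (unimodular) diagonal. -/
theorem l2_opNorm_spinorLift_gammaFive_le {L N : ℕ} [NeZero L] :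
    ‖(spinorLift gammaFive :
        Matrix (TorusSite 4 L × Fin N × Fin 4) (TorusSite 4 L × Fin N × Fin 4) ℂ)‖ ≤ 1 := by
  rw [spinorLift_gammaFive_eq_diagonal, Matrix.l2_opNorm_diagonal]
  refine (pi_norm_le_iff_of_nonneg zero_le_one).mpr fun p => ?_
  have h : ∀ α : Fin 4, ‖(![1, 1, -1, -1] : Fin 4 → ℂ) α‖ ≤ 1 := by
    intro α
    fin_cases α <;> simp
  exact h p.2.2

/-- Every characteristic root of `γ₅ D_W(U; m₀, 1)`, `m₀ ∈ [-2, 2]`, has modulus at most `10`: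
a root of the characteristic polynomial lies in the spectrum, whose elements are bounded by the
`ℓ²` operator norm `‖γ₅ D_W‖ ≤ ‖γ₅‖ ‖D_W‖ ≤ 1 · (|m₀ + 4| + 4) ≤ 10` (HJL (2.14)). -/
theorem norm_le_of_mem_roots_charpoly_gammaFive_wilsonDirac {m₀ : ℝ} (hm₁ : -2 ≤ m₀)
    (hm₂ : m₀ ≤ 2) {L : ℕ} [NeZero L] (U : GaugeConfig 4 L (Matrix.specialUnitaryGroup (Fin 3) ℂ))
    {z : ℂ} (hz : z ∈ (spinorLift gammaFive *
      wilsonDirac (fundamentalRep (Fin 3)) U m₀ 1).charpoly.roots) : ‖z‖ ≤ 10 := by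
  set A := spinorLift gammaFive * wilsonDirac (fundamentalRep (Fin 3)) U m₀ 1
  have hD : ‖wilsonDirac (fundamentalRep (Fin 3)) U m₀ 1‖ ≤ 10 := by
    refine (l2_opNorm_wilsonDirac_le (fundamentalRep (Fin 3)) fundamentalRep_mem_unitaryGroup
      U m₀).trans ?_
    rw [abs_of_nonneg (by linarith)]
    linarith
  have hAn : ‖A‖ ≤ 10 :=
    calc ‖A‖ ≤ ‖(spinorLift gammaFive :
            Matrix (TorusSite 4 L × Fin 3 × Fin 4) (TorusSite 4 L × Fin 3 × Fin 4) ℂ)‖ *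
          ‖wilsonDirac (fundamentalRep (Fin 3)) U m₀ 1‖ := norm_mul_le _ _
      _ ≤ 1 * 10 :=
          mul_le_mul l2_opNorm_spinorLift_gammaFive_le hD (norm_nonneg _) zero_le_one
      _ = 10 := one_mul _
  have hz' : z ∈ spectrum ℂ A := by
    rw [Matrix.mem_spectrum_iff_isRoot_charpoly]
    exact (Polynomial.mem_roots A.charpoly_monic.ne_zero).1 hz
  exact (spectrum.norm_le_norm_of_mem hz').trans hAn

/-- Window saturation for the Hermitian Wilson–Dirac operator: every characteristic root of `γ₅ D_W(U; m₀, r=1)`, `m₀ ∈ [−2,2]`, has real part of modulus `< 11` (indeed modulus `≤ |m₀+4|+4 ≤ 10`), so the in-window count is `Fintype.card` of the index type. -/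
theorem stub_window : ∀ (m₀ : ℝ), -2 ≤ m₀ → m₀ ≤ 2 → ∀ (L : ℕ) [NeZero L]
    (U : GaugeConfig 4 L (Matrix.specialUnitaryGroup (Fin 3) ℂ)),
    Multiset.countP (fun z : ℂ => |z.re| < 11)
        (spinorLift gammaFive * wilsonDirac (fundamentalRep (Fin 3)) U m₀ 1).charpoly.roots =
      Fintype.card (TorusSite 4 L × Fin 3 × Fin 4) := by
  intro m₀ hm₁ hm₂ L _ U
  have hroot : ∀ z ∈ (spinorLift gammaFive *
      wilsonDirac (fundamentalRep (Fin 3)) U m₀ 1).charpoly.roots, |z.re| < 11 := fun z hz =>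
    lt_of_le_of_lt ((Complex.abs_re_le_norm z).trans
      (norm_le_of_mem_roots_charpoly_gammaFive_wilsonDirac hm₁ hm₂ U hz)) (by norm_num)
  rw [Multiset.countP_eq_card.mpr hroot, IsAlgClosed.card_roots_eq_natDegree,
    Matrix.charpoly_natDegree_eq_dim]

end Summit.QuantumFields.QCD.Theorems.RandomRefit

end
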